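import Summits.BirchSwinnertonDyer.BirchSwinnertonDyer.Theorems.GoldfeldAllTwistsTwoConverseTwinBirchTorsionK
import Summits.BirchSwinnertonDyer.BirchSwinnertonDyer.Theorems.GoldfeldAllTwistsTwoConverseTwinAdditivePrimeTwistDescent
import Summits.BirchSwinnertonDyer.BirchSwinnertonDyer.Theorems.GoldfeldAllTwistsTwoConverseTwinHeegnerIndexX049
import Summits.BirchSwinnertonDyer.BirchSwinnertonDyer.Theorems.GoldfeldAllTwistsTwoConverseTwinGenusOddMultipleTrace
import Literature.NumberTheory.EllipticCurves.TwoIsogenySelmerGroupRankProofs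
import Literature.NumberTheory.EllipticCurves.VariableChangePointsMap
import HarnessLib

set_option linter.dupNamespace false -- `…BirchSwinnertonDyer.BirchSwinnertonDyer…` is the cell's namespace (D-0017)
set_option autoImplicit false

/-!
# LINE B49 — THEOREM B, local input (B1c-β): the HALVABILITY VALUE is `k = 1` on the whole inert prime
# family — a rational point of `49a1^{(−q)}` that is not divisible by `2` over `K = ℚ(√−q)`

Cell `bsd-goldfeld`, seat `bsd-goldfeld-s1p-c301` (prover, gen 8); planner ruling g19 (liii) (THEOREM B = clause
(ii) of `X049BirchLemmaEvenDiscr`), scope memo `HOME/GENUS-THEOREM-B.md` factor F10 («halvability `k` DECIDED by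
descent uniformly in `q`»). Support for item `stmt-BirchSwinnertonDyer-19140` (twin″); Theses-free; theorems only.
HONEST FRAMING: a statement about the Mordell–Weil group of the twists `49a1^{(−q)}`; nothing about `L`-values or
BSD is proved; the rank-one hypothesis is a binder (on the family it follows from Gross–Zagier–Kolyvagin).

THE HALVABILITY VALUE. In seat c301's `X049BirchLemmaEvenDiscr` the factor `k ∈ {1, 2}` of the `L`-free quotient
`𝔮₄₉` is `2` iff every `y ∈ W(ℚ)` is divisible by `2` in `W(K)` up to torsion (`W` a model of `49a1^{(−q)}`,
`K = ℚ(√−q)`). WHAT IS PROVED (uniformly in the prime `q ≡ 1 (mod 4)` with `(q/7) = −1`), on the two-torsion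
model `E_q = ⟨0, −21q, 0, 112q², 0⟩` of `49a1^{(−q)}` (seat c301 gen 2):
* §1 **the descent image has four elements in rank one**: `α(E_q(ℚ)) ⊆ S(−21q, 112q²) ⊆ {1, 2, 7, 14}` (gen 2's
  Selmer bound) and `#α · #α′ = 2^{rank+2} = 8` (Silverman–Tate, tree `natCard_range_xSqClass_mul`) with
  `#α′ ≤ #S′ ≤ 2` (gen 2: `S′(42q, −7q²) ⊆ {1, −7}`), so `α(E_q(ℚ)) = {[1],[2],[7],[14]}`; in particular SOME
  rational point `P` has `α(P) = [2]` (`exists_xSqClass_eq_two_primeTwist`);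
* §2 **such a point is not in `2E_q(K) + E_q(K)_tors`** (`incl_sub_two_zsmul_not_mem_torsion_of_xSqClass_eq_two`):
  `x(P) = 2r²`, and `2`, `2·112 ~ 14`, `b = 112q² ~ 7`, `a² − 4b = −7q² ~ −7` are NOT squares in `K`
  (`not_isSquare_inertField`), so Silverman–Tate's `α` over `K` forbids it (tree
  `some_ne_two_zsmul_add_of_not_isSquare`);
* §3 transport to ANY model `W = Cd • X₀(49)^{(d_K)}` of `49a1^{(−q)}` of rank one
  (**`not_forall_halvable_inertPrimeTwist`**): NOT every `y ∈ W(ℚ)` is halvable in `W(K)` up to torsion — i.e.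
  the `k = 2` branch of `X049BirchLemmaEvenDiscr` is EMPTY and `𝔮₄₉` is read at `k = 1`.
References: [SilvermanTate2015] §3.5–3.6; [SilvermanAEC2009] X.4.9, Exercise 10.16; census: TWIN-CENSUS-G3 §3
(`m ≡ 2 (mod 4)` on all 1011 prime rows) and B49-GENUS §4 (`kbits = 0`, 62/62).
-/

noncomputable section

open scoped Classical

open WeierstrassCurve Literature.NumberTheory.EllipticCurves Literature.NumberTheory.EllipticCurves.ModularForms
  WeierstrassCurve.QuadraticDescent
open WeierstrassCurve.Affine (sqClass sqClass_mul sqClass_eq_one_iff)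

namespace Summit.BirchSwinnertonDyer.BirchSwinnertonDyer.Theorems.GoldfeldGoodTwists

/-! ## §1 In rank one the descent image of `E_q = ⟨0, −21q, 0, 112q², 0⟩` is `{1, 2, 7, 14}` -/

section Descent

variable {l : ℕ}

/-- **`#α′(E′_q(ℚ)) ≤ 2`** for the `2`-isogenous curve `E′_q = ⟨0, 42q, 0, −7q², 0⟩`: `2^{dim S′} = #α′ · #Ш-part`
(tree `two_pow_twoIsogenySelmerRank'_eq_natCard_mul`) and `#S′(42q, −7q²) ≤ 2` (seat c301 gen 2).
[cite: SilvermanAEC2009, Thm. X.4.2(a) and Prop. X.4.9] -/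
theorem natCard_range_xSqClass_codomain_le_two_primeTwist [Fact l.Prime] (hl4 : l % 4 = 1)
    (hl7 : legendreSym l (-7) = -1)
    [hE : (⟨0, ((-21 * l : ℤ) : ℚ), 0, ((112 * l ^ 2 : ℤ) : ℚ), 0⟩ : WeierstrassCurve ℚ).IsElliptic] :
    Nat.card (Set.range (⟨0, ((-2 * (-21 * l) : ℤ) : ℚ), 0, (((-21 * l) ^ 2 - 4 * (112 * l ^ 2) : ℤ) : ℚ), 0⟩ :
      WeierstrassCurve ℚ).xSqClass) ≤ 2 := by
  have hl : l.Prime := Fact.out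
  have hab := hab_primeTwist hl
  have h := two_pow_twoIsogenySelmerRank'_eq_natCard_mul hab
  have hS' : 2 ^ twoIsogenySelmerRank' (-21 * l) (112 * l ^ 2) ≤ 2 := by
    rw [two_pow_twoIsogenySelmerRank'_eq_card hab]
    exact le_trans (Finset.card_le_card fun d hd => mem_of_mem_twoIsogenySelmerGroup'_primeTwist hl4 hl7 hd)
      Finset.card_le_two
  have hm : 1 ≤ Nat.card ↥((⟨0, ((-21 * l : ℤ) : ℚ), 0, ((112 * l ^ 2 : ℤ) : ℚ), 0⟩ : WeierstrassCurve ℚ).sha ⊓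
      (⟨0, ((-21 * l : ℤ) : ℚ), 0, ((112 * l ^ 2 : ℤ) : ℚ), 0⟩ : WeierstrassCurve ℚ).twoIsogenyTorsorHom.range) := by
    refine Nat.one_le_iff_ne_zero.mpr fun h0 => ?_
    rw [h0, mul_zero] at h
    exact pow_ne_zero _ two_ne_zero h
  calc _ ≤ _ * Nat.card ↥((⟨0, ((-21 * l : ℤ) : ℚ), 0, ((112 * l ^ 2 : ℤ) : ℚ), 0⟩ : WeierstrassCurve ℚ).sha ⊓
          (⟨0, ((-21 * l : ℤ) : ℚ), 0, ((112 * l ^ 2 : ℤ) : ℚ), 0⟩ : WeierstrassCurve ℚ).twoIsogenyTorsorHom.range) :=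
        Nat.le_mul_of_pos_right _ hm
    _ = 2 ^ twoIsogenySelmerRank' (-21 * l) (112 * l ^ 2) := h.symm
    _ ≤ 2 := hS'

/-- `{1, 2, 7, 14}` has four elements. [folklore] -/
theorem card_one_two_seven_fourteen : ({1, 2, 7, 14} : Finset ℤ).card = 4 := by decide

/-- **In rank one, some rational point of `E_q` has `α(P) = [2]`**: `#α(E_q(ℚ)) · #α′ = 2^{1+2} = 8` with `#α′ ≤ 2`
forces `#α(E_q(ℚ)) = 4`; as `α(E_q(ℚ)) ⊆ [S(−21q, 112q²)] ⊆ {[1],[2],[7],[14]}`, equality holds and `[2]` is attained.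
[cite: SilvermanTate2015, §3.6 (2^r = #α(Γ)·#ᾱ(Γ̄)/4)] [cite: SilvermanAEC2009, Prop. X.4.9] -/
theorem exists_xSqClass_eq_two_primeTwist [Fact l.Prime] (hl4 : l % 4 = 1) (hl7 : legendreSym l (-7) = -1)
    [hE : (⟨0, ((-21 * l : ℤ) : ℚ), 0, ((112 * l ^ 2 : ℤ) : ℚ), 0⟩ : WeierstrassCurve ℚ).IsElliptic]
    (hr : (⟨0, ((-21 * l : ℤ) : ℚ), 0, ((112 * l ^ 2 : ℤ) : ℚ), 0⟩ : WeierstrassCurve ℚ).mordellWeilRank = 1) :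
    ∃ P : (⟨0, ((-21 * l : ℤ) : ℚ), 0, ((112 * l ^ 2 : ℤ) : ℚ), 0⟩ : WeierstrassCurve ℚ).toAffine.Point,
      (⟨0, ((-21 * l : ℤ) : ℚ), 0, ((112 * l ^ 2 : ℤ) : ℚ), 0⟩ : WeierstrassCurve ℚ).xSqClass P = sqClass (2 : ℚ) := by
  have hl : l.Prime := Fact.out
  have hab := hab_primeTwist hl
  have hN' := natCard_range_xSqClass_codomain_le_two_primeTwist hl4 hl7 (hE := hE)
  -- `#α · #α′ = 8`
  have hcount := (⟨0, ((-21 * l : ℤ) : ℚ), 0, ((112 * l ^ 2 : ℤ) : ℚ), 0⟩ : WeierstrassCurve ℚ).natCard_range_xSqClass_mul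
  have h8 : (2 : ℕ) ^ ((1 : ℕ) + 2) = 8 := by norm_num
  rw [twoIsogenyCodomain_mk_intCast, hr, h8] at hcount
  -- `#α ≥ 4`
  have hN : 4 ≤ Nat.card (Set.range (⟨0, ((-21 * l : ℤ) : ℚ), 0, ((112 * l ^ 2 : ℤ) : ℚ), 0⟩ :
      WeierstrassCurve ℚ).xSqClass) := by
    by_contra hlt
    rw [not_le] at hlt
    have h6 : Nat.card (Set.range (⟨0, ((-21 * l : ℤ) : ℚ), 0, ((112 * l ^ 2 : ℤ) : ℚ), 0⟩ :
        WeierstrassCurve ℚ).xSqClass) *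
        Nat.card (Set.range (⟨0, ((-2 * (-21 * l) : ℤ) : ℚ), 0, (((-21 * l) ^ 2 - 4 * (112 * l ^ 2) : ℤ) : ℚ), 0⟩ :
          WeierstrassCurve ℚ).xSqClass) ≤ 3 * 2 := Nat.mul_le_mul (by omega) hN'
    omega
  -- `α(E(ℚ)) ⊆ [S] ⊆ {[1],[2],[7],[14]}`, with `#S ≤ 4`
  set S := twoIsogenySelmerGroup (-21 * (l : ℤ)) (112 * (l : ℤ) ^ 2) with hS
  have hsub := range_xSqClass_subset_image_twoIsogenySelmerGroup hab
  have hS4 : S ⊆ ({1, 2, 7, 14} : Finset ℤ) := fun d hd => mem_of_mem_twoIsogenySelmerGroup_primeTwist hl7 hd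
  have hfinT : (↑(S.image fun d : ℤ => sqClass (d : ℚ)) : Set (Affine.SqUnits ℚ)).Finite := Finset.finite_toSet _
  have hTle : (S.image fun d : ℤ => sqClass (d : ℚ)).card ≤ 4 :=
    le_trans Finset.card_image_le (le_trans (Finset.card_le_card hS4) card_one_two_seven_fourteen.le)
  have hrange : Set.range (⟨0, ((-21 * l : ℤ) : ℚ), 0, ((112 * l ^ 2 : ℤ) : ℚ), 0⟩ : WeierstrassCurve ℚ).xSqClass =
      ↑(S.image fun d : ℤ => sqClass (d : ℚ)) := by
    refine Set.eq_of_subset_of_ncard_le hsub ?_ hfinT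
    rw [Set.ncard_coe_finset, ← Nat.card_coe_set_eq]
    exact le_trans hTle hN
  have hScard : 4 ≤ S.card := by
    calc 4 ≤ Nat.card (Set.range (⟨0, ((-21 * l : ℤ) : ℚ), 0, ((112 * l ^ 2 : ℤ) : ℚ), 0⟩ :
          WeierstrassCurve ℚ).xSqClass) := hN
      _ = (Set.range (⟨0, ((-21 * l : ℤ) : ℚ), 0, ((112 * l ^ 2 : ℤ) : ℚ), 0⟩ :
          WeierstrassCurve ℚ).xSqClass).ncard := Nat.card_coe_set_eq _
      _ = (↑(S.image fun d : ℤ => sqClass (d : ℚ)) : Set (Affine.SqUnits ℚ)).ncard := by rw [hrange]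
      _ = (S.image fun d : ℤ => sqClass (d : ℚ)).card := Set.ncard_coe_finset _
      _ ≤ S.card := Finset.card_image_le
  have hSeq : S = ({1, 2, 7, 14} : Finset ℤ) :=
    Finset.eq_of_subset_of_card_le hS4 (by rw [card_one_two_seven_fourteen]; exact hScard)
  have h2S : (2 : ℤ) ∈ S := by rw [hSeq]; decide
  have h2 : sqClass ((2 : ℤ) : ℚ) ∈ Set.range (⟨0, ((-21 * l : ℤ) : ℚ), 0, ((112 * l ^ 2 : ℤ) : ℚ), 0⟩ :
      WeierstrassCurve ℚ).xSqClass := by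
    rw [hrange, Finset.mem_coe]
    exact Finset.mem_image_of_mem _ h2S
  obtain ⟨P, hP⟩ := h2
  exact ⟨P, by rw [hP]; norm_cast⟩

end Descent

/-! ## §2 A point with `α(P) = [2]` is not divisible by `2` over `K = ℚ(√−q)` -/

section NotHalvable

variable {K : Type} [Field K] [NumberField K]

/-- `E_q ⊗ K` is the literal two-torsion model over `K`. [folklore] -/
theorem primeTwistModel_baseChange (q : ℕ) :
    (⟨0, ((-21 * q : ℤ) : ℚ), 0, ((112 * q ^ 2 : ℤ) : ℚ), 0⟩ : WeierstrassCurve ℚ).baseChange K =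
      (⟨0, -21 * (q : K), 0, 112 * (q : K) ^ 2, 0⟩ : WeierstrassCurve K) := by
  ext <;> simp [WeierstrassCurve.baseChange]

/-- **A rational point `P` of `E_q` with `α(P) = [2]` is not in `2E_q(K) + E_q(K)_tors`** for `K` imaginary
quadratic with `d_K = −4q`: `x(P) = 2r² ≠ 0` and `x(P)`, `x(P)·b ~ 14`, `b ~ 7`, `a² − 4b ~ −7` are not squares
in `K` (`not_isSquare_inertField`) — Silverman–Tate's `α` over `K` (tree `some_ne_two_zsmul_add_of_not_isSquare`).
[cite: SilvermanTate2015, §3.5] -/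
theorem incl_ne_two_zsmul_add_of_xSqClass_eq_two (hK : IsImaginaryQuadratic K) {q : ℕ} (hq : q.Prime)
    (hq7 : jacobiSym q 7 = -1) (hdK : NumberField.discr K = -(4 * (q : ℤ)))
    [hE : (⟨0, ((-21 * q : ℤ) : ℚ), 0, ((112 * q ^ 2 : ℤ) : ℚ), 0⟩ : WeierstrassCurve ℚ).IsElliptic]
    {P : (⟨0, ((-21 * q : ℤ) : ℚ), 0, ((112 * q ^ 2 : ℤ) : ℚ), 0⟩ : WeierstrassCurve ℚ).toAffine.Point}
    (hP : (⟨0, ((-21 * q : ℤ) : ℚ), 0, ((112 * q ^ 2 : ℤ) : ℚ), 0⟩ : WeierstrassCurve ℚ).xSqClass P = sqClass (2 : ℚ))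
    (R t : ((⟨0, ((-21 * q : ℤ) : ℚ), 0, ((112 * q ^ 2 : ℤ) : ℚ), 0⟩ : WeierstrassCurve ℚ).baseChange K).toAffine.Point)
    (ht : IsOfFinAddOrder t) :
    incl K (⟨0, ((-21 * q : ℤ) : ℚ), 0, ((112 * q ^ 2 : ℤ) : ℚ), 0⟩ : WeierstrassCurve ℚ) P ≠ (2 : ℤ) • R + t := by
  obtain ⟨hq2, hq7'⟩ := ne_two_and_ne_seven_of_jacobiSym hq7
  obtain ⟨h7, h7', h2, h14⟩ := not_isSquare_inertField hK hq hq7 hdK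
  obtain ⟨-, -, -, ⟨n2, -⟩, -, ⟨n14, -⟩⟩ := not_isSquare_genusConstants hq hq2 hq7'
  have hq0 : (q : ℚ) ≠ 0 := by exact_mod_cast hq.ne_zero
  have hqK : (q : K) ≠ 0 := by exact_mod_cast hq.ne_zero
  have hb : ((112 * q ^ 2 : ℤ) : ℚ) ≠ 0 := by push_cast; positivity
  rcases P with _ | ⟨x, y, h⟩
  · -- `α(O) = 1 ≠ [2]`
    exfalso
    have hP' : (⟨0, ((-21 * q : ℤ) : ℚ), 0, ((112 * q ^ 2 : ℤ) : ℚ), 0⟩ : WeierstrassCurve ℚ).xSqClass 0 =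
        sqClass (2 : ℚ) := hP
    rw [xSqClass_zero, eq_comm, sqClass_eq_one_iff two_ne_zero] at hP'
    obtain ⟨u, hu⟩ := hP'
    exact n2 ⟨u, by rw [hu]; ring⟩
  · by_cases hx : x = 0
    · -- `α(T) = [b] = [112q²] ≠ [2]` (`224q² = 14·(4q)²` is not a square)
      exfalso
      rw [xSqClass_some_of_eq_zero _ hx] at hP
      change sqClass (((112 * q ^ 2 : ℤ) : ℚ)) = sqClass (2 : ℚ) at hP
      have h1 : sqClass (((112 * q ^ 2 : ℤ) : ℚ) * 2) = 1 := by
        rw [sqClass_mul hb two_ne_zero, hP, Affine.SqUnits.mul_self]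
      obtain ⟨u, hu⟩ := (sqClass_eq_one_iff (mul_ne_zero hb two_ne_zero)).mp h1
      refine n14 (isSquare_of_sq_mul (k := 4 * (q : ℚ)) (by positivity) (r := u) ?_)
      push_cast at hu
      linear_combination hu.symm
    · rw [xSqClass_some_of_ne_zero _ hx] at hP
      -- `2x = u²`
      obtain ⟨u, hu⟩ := (sqClass_eq_one_iff (mul_ne_zero hx two_ne_zero)).mp
        (by rw [sqClass_mul hx two_ne_zero, hP, Affine.SqUnits.mul_self])
      have hu0 : u ≠ 0 := by rintro rfl; exact mul_ne_zero hx two_ne_zero (by rw [hu]; ring)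
      -- over `K`
      haveI : ((⟨0, ((-21 * q : ℤ) : ℚ), 0, ((112 * q ^ 2 : ℤ) : ℚ), 0⟩ : WeierstrassCurve ℚ).baseChange K).IsTwoTorsionNF :=
        ⟨by simp [WeierstrassCurve.baseChange], by simp [WeierstrassCurve.baseChange], by simp [WeierstrassCurve.baseChange]⟩
      have hD : ¬ IsSquare (((⟨0, ((-21 * q : ℤ) : ℚ), 0, ((112 * q ^ 2 : ℤ) : ℚ), 0⟩ : WeierstrassCurve ℚ).baseChange K).a₂ ^ 2 -
          4 * ((⟨0, ((-21 * q : ℤ) : ℚ), 0, ((112 * q ^ 2 : ℤ) : ℚ), 0⟩ : WeierstrassCurve ℚ).baseChange K).a₄) := by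
        have e : ((⟨0, ((-21 * q : ℤ) : ℚ), 0, ((112 * q ^ 2 : ℤ) : ℚ), 0⟩ : WeierstrassCurve ℚ).baseChange K).a₂ ^ 2 -
            4 * ((⟨0, ((-21 * q : ℤ) : ℚ), 0, ((112 * q ^ 2 : ℤ) : ℚ), 0⟩ : WeierstrassCurve ℚ).baseChange K).a₄ =
            -7 * ((q : K) * (q : K)) := by
          simp [WeierstrassCurve.baseChange]; ring
        rw [e]; rintro ⟨r, hr⟩
        exact h7 (isSquare_of_sq_mul (k := (q : K)) hqK (r := r) (by linear_combination hr.symm))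
      have hbK : ¬ IsSquare ((⟨0, ((-21 * q : ℤ) : ℚ), 0, ((112 * q ^ 2 : ℤ) : ℚ), 0⟩ : WeierstrassCurve ℚ).baseChange K).a₄ := by
        have e : ((⟨0, ((-21 * q : ℤ) : ℚ), 0, ((112 * q ^ 2 : ℤ) : ℚ), 0⟩ : WeierstrassCurve ℚ).baseChange K).a₄ =
            7 * ((4 * (q : K)) * (4 * (q : K))) := by
          simp [WeierstrassCurve.baseChange]; ring
        rw [e]; rintro ⟨r, hr⟩
        exact h7' (isSquare_of_sq_mul (k := 4 * (q : K)) (mul_ne_zero (by norm_num) hqK) (r := r)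
          (by linear_combination hr.symm))
      have hxK : (algebraMap ℚ K x) ≠ 0 := by rw [eq_ratCast]; exact_mod_cast hx
      have h₁ : ¬ IsSquare (algebraMap ℚ K x) := by
        rw [eq_ratCast]; rintro ⟨r, hr⟩
        have hr0 : r ≠ 0 := by rintro rfl; exact hxK (by rw [eq_ratCast, hr, mul_zero])
        refine h2 (isSquare_of_sq_mul (k := r) hr0 (r := (u : K)) ?_)
        have hu' : ((x : ℚ) : K) * 2 = (u : K) ^ 2 := by exact_mod_cast congrArg (fun z : ℚ => (z : K)) hu
        linear_combination -hu' + 2 * hr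
      have h₂ : ¬ IsSquare (algebraMap ℚ K x *
          ((⟨0, ((-21 * q : ℤ) : ℚ), 0, ((112 * q ^ 2 : ℤ) : ℚ), 0⟩ : WeierstrassCurve ℚ).baseChange K).a₄) := by
        have e : ((⟨0, ((-21 * q : ℤ) : ℚ), 0, ((112 * q ^ 2 : ℤ) : ℚ), 0⟩ : WeierstrassCurve ℚ).baseChange K).a₄ =
            112 * (q : K) ^ 2 := by simp [WeierstrassCurve.baseChange]
        rw [e, eq_ratCast]; rintro ⟨r, hr⟩
        have hu' : ((x : ℚ) : K) * 2 = (u : K) ^ 2 := by exact_mod_cast congrArg (fun z : ℚ => (z : K)) hu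
        refine h14 (isSquare_of_sq_mul (k := 2 * (u : K) * q) ?_ (r := r) ?_)
        · exact mul_ne_zero (mul_ne_zero two_ne_zero (by exact_mod_cast hu0)) hqK
        · linear_combination hr.symm + 56 * (q : K) ^ 2 * hu'
      intro hPt
      have hmap : incl K (⟨0, ((-21 * q : ℤ) : ℚ), 0, ((112 * q ^ 2 : ℤ) : ℚ), 0⟩ : WeierstrassCurve ℚ) (.some x y h) =
          .some (algebraMap ℚ K x) (algebraMap ℚ K y) ((Affine.baseChange_nonsingular
            (W := (⟨0, ((-21 * q : ℤ) : ℚ), 0, ((112 * q ^ 2 : ℤ) : ℚ), 0⟩ : WeierstrassCurve ℚ))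
            (f := Algebra.ofId ℚ K) (algebraMap ℚ K).injective x y).mpr h) := rfl
      rw [hmap] at hPt
      exact some_ne_two_zsmul_add_of_not_isSquare _ hD hbK _ hxK h₁ h₂ R t ht hPt

/-- The same as a statement about the torsion subgroup: `ι(P) − 2•Q ∉ E_q(K)_tors` for every `Q ∈ E_q(K)`.
[cite: SilvermanTate2015, §3.5] -/
theorem incl_sub_two_zsmul_not_mem_torsion_of_xSqClass_eq_two (hK : IsImaginaryQuadratic K) {q : ℕ}
    (hq : q.Prime) (hq7 : jacobiSym q 7 = -1) (hdK : NumberField.discr K = -(4 * (q : ℤ)))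
    [hE : (⟨0, ((-21 * q : ℤ) : ℚ), 0, ((112 * q ^ 2 : ℤ) : ℚ), 0⟩ : WeierstrassCurve ℚ).IsElliptic]
    {P : (⟨0, ((-21 * q : ℤ) : ℚ), 0, ((112 * q ^ 2 : ℤ) : ℚ), 0⟩ : WeierstrassCurve ℚ).toAffine.Point}
    (hP : (⟨0, ((-21 * q : ℤ) : ℚ), 0, ((112 * q ^ 2 : ℤ) : ℚ), 0⟩ : WeierstrassCurve ℚ).xSqClass P = sqClass (2 : ℚ))
    (Q : ((⟨0, ((-21 * q : ℤ) : ℚ), 0, ((112 * q ^ 2 : ℤ) : ℚ), 0⟩ : WeierstrassCurve ℚ).baseChange K).toAffine.Point) :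
    incl K (⟨0, ((-21 * q : ℤ) : ℚ), 0, ((112 * q ^ 2 : ℤ) : ℚ), 0⟩ : WeierstrassCurve ℚ) P - (2 : ℤ) • Q ∉
      AddCommGroup.torsion ((⟨0, ((-21 * q : ℤ) : ℚ), 0, ((112 * q ^ 2 : ℤ) : ℚ), 0⟩ : WeierstrassCurve ℚ).baseChange K).toAffine.Point := by
  intro hmem
  have ht : IsOfFinAddOrder (incl K (⟨0, ((-21 * q : ℤ) : ℚ), 0, ((112 * q ^ 2 : ℤ) : ℚ), 0⟩ : WeierstrassCurve ℚ) P -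
      (2 : ℤ) • Q) := (AddCommGroup.mem_torsion _).mp hmem
  exact incl_ne_two_zsmul_add_of_xSqClass_eq_two hK hq hq7 hdK hP Q _ ht (by abel)

end NotHalvable

/-! ## §3 Transport to every model of `49a1^{(−q)}`: the halvability value is `k = 1` -/

section Transport

variable {K : Type} [Field K] [NumberField K]

/-- Base change of the inclusion along an equality of curves. [folklore] -/
theorem congrEquiv_incl {W₁ W₂ : WeierstrassCurve ℚ} (h : W₁ = W₂) (y : W₁.toAffine.Point) :
    Affine.Point.congrEquiv (congrArg (fun V : WeierstrassCurve ℚ => V.baseChange K) h) (incl K W₁ y) =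
      incl K W₂ (Affine.Point.congrEquiv h y) := by
  subst h
  rfl

/-- The substitution over `K` of a `ℚ`-change of variables carries `ι(y)` to `ι(C • y)`. [cite: SilvermanAEC2009, III.3.1(b)] -/
theorem pointEquivBaseChange_incl (W : WeierstrassCurve ℚ) (C : VariableChange ℚ) (y : W.toAffine.Point) :
    VariableChange.pointEquivBaseChange W C K (incl K W y) = incl K (C • W) (VariableChange.pointEquiv W C y) := by
  rcases y with _ | ⟨x, y, h⟩
  · simp only [← Affine.Point.zero_def, map_zero]
  · show VariableChange.pointEquivBaseChange W C K (.some (algebraMap ℚ K x) (algebraMap ℚ K y) _) =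
      incl K _ (VariableChange.pointEquiv W C (.some x y h))
    rw [VariableChange.pointEquivBaseChange_some, VariableChange.pointEquiv_some]
    show _ = Affine.Point.some (algebraMap ℚ K (C.toX x)) (algebraMap ℚ K (C.toY x y)) _
    congr 1
    · simp only [VariableChange.toX_def, VariableChange.map, map_mul, map_pow, map_sub, Units.coe_map_inv,
        MonoidHom.coe_coe]
    · simp only [VariableChange.toY_def, VariableChange.map, map_mul, map_pow, map_sub, Units.coe_map_inv,
        MonoidHom.coe_coe]

/-- **THE HALVABILITY VALUE IS `k = 1` ON THE WHOLE INERT PRIME FAMILY.** For `q` prime with `(q/7) = −1`, `K`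
imaginary quadratic with `d_K = −4q`, and ANY model `W = Cd • X₀(49)^{(d_K)}` of `49a1^{(−q)}` with `rank W(ℚ) = 1`:
NOT every `y ∈ W(ℚ)` is divisible by `2` in `W(K)` up to torsion. (Transport of §§1–2 along the `ℚ`-isomorphism
`C • W = E_q`, seat c301 gen 2's `smul_eq_twoTorsionModel_primeTwist`, and its base change to `K`,
`VariableChange.pointEquivBaseChange`.) In `X049BirchLemmaEvenDiscr` this empties the `k = 2` branch.
[cite: SilvermanTate2015, §3.5–3.6] [cite: SilvermanAEC2009, Prop. X.4.9 and Exercise 10.16] -/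
theorem not_forall_halvable_inertPrimeTwist (hK : IsImaginaryQuadratic K) {q : ℕ} (hq : q.Prime)
    (hq7 : jacobiSym q 7 = -1) (hdK : NumberField.discr K = -(4 * (q : ℤ)))
    (W : WeierstrassCurve ℚ) [W.IsElliptic] (Cd : VariableChange ℚ)
    (hW : Cd • cm7.quadraticTwist (NumberField.discr K : ℚ) = W) (hr : W.mordellWeilRank = 1) :
    ¬ ∀ y : W.toAffine.Point, ∃ Q : (W.baseChange K).toAffine.Point,
        incl K W y - (2 : ℤ) • Q ∈ AddCommGroup.torsion (W.baseChange K).toAffine.Point := by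
  haveI := Fact.mk hq
  have hq4 : q % 4 = 1 := emod_four_of_discr_eq hK hq hq7 hdK
  have hl7 : legendreSym q (-7) = -1 := by rw [← jacobiSym_seven_eq_legendreSym_neg_seven hq4]; exact hq7
  -- `C • W = E_q`
  obtain ⟨C₁, hC₁⟩ := exists_smul_eq_quadraticTwist_neg_of_discr K hdK W Cd hW
  have hCE := smul_eq_twoTorsionModel_primeTwist W C₁ hC₁
  set C : VariableChange ℚ := ⟨(Units.mk0 (2 : ℚ) two_ne_zero)⁻¹, 2 * ((-q : ℤ) : ℚ), 0, 0⟩ * C₁ with hC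
  haveI hE : (⟨0, ((-21 * q : ℤ) : ℚ), 0, ((112 * q ^ 2 : ℤ) : ℚ), 0⟩ : WeierstrassCurve ℚ).IsElliptic := by
    rw [← hCE]; infer_instance
  -- rank transport
  have hrE : (⟨0, ((-21 * q : ℤ) : ℚ), 0, ((112 * q ^ 2 : ℤ) : ℚ), 0⟩ : WeierstrassCurve ℚ).mordellWeilRank = 1 := by
    rw [← mordellWeilRank_congr hCE, ← hr]
    have h := mordellWeilRank_variableChange_holds W C
    unfold mordellWeilRank_variableChange at h
    convert h using 2
  obtain ⟨P, hP⟩ := exists_xSqClass_eq_two_primeTwist hq4 hl7 (hE := hE) hrE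
  intro hall
  -- the rational point `y = C⁻¹ • P` of `W` and its hypothetical half `Q ∈ W(K)`
  set e₀ := (VariableChange.pointEquiv W C).trans (Affine.Point.congrEquiv hCE) with he₀
  obtain ⟨Q, hQ⟩ := hall (e₀.symm P)
  -- push forward to `E_q(K)`
  set Φ := (VariableChange.pointEquivBaseChange W C K).trans
    (Affine.Point.congrEquiv (congrArg (fun V : WeierstrassCurve ℚ => V.baseChange K) hCE)) with hΦ
  have hΦy : Φ (incl K W (e₀.symm P)) = incl K _ P := by
    rw [hΦ, AddEquiv.trans_apply, pointEquivBaseChange_incl, congrEquiv_incl hCE]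
    congr 1
    rw [he₀]
    simp only [AddEquiv.symm_trans_apply]
    rw [AddEquiv.apply_symm_apply, AddEquiv.apply_symm_apply]
  have hmem : incl K _ P - (2 : ℤ) • Φ Q ∈ AddCommGroup.torsion
      ((⟨0, ((-21 * q : ℤ) : ℚ), 0, ((112 * q ^ 2 : ℤ) : ℚ), 0⟩ : WeierstrassCurve ℚ).baseChange K).toAffine.Point := by
    rw [← hΦy, ← map_zsmul, ← map_sub]
    exact (AddCommGroup.mem_torsion _).mpr (Φ.toAddMonoidHom.isOfFinAddOrder ((AddCommGroup.mem_torsion _).mp hQ))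
  exact incl_sub_two_zsmul_not_mem_torsion_of_xSqClass_eq_two hK hq hq7 hdK hP (Φ Q) hmem

end Transport

end Summit.BirchSwinnertonDyer.BirchSwinnertonDyer.Theorems.GoldfeldGoodTwists

end
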